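import Summits.CriticalPhenomena.PercolationContinuityZ3.Theorems.PercNearOneGluingNoHeavyLowerTailCILIsolatedObserver
import HarnessLib

/-!
# `NoHeavyLowerTail` (stmt-CriticalPhenomena-4575) — the cumulative isolation lemma for observers whose
# non-relay neighbours are DOMINATED (Kozma–Nitzan's Theorem 8 without the isolation hypothesis)

Support file for the crux `NoHeavyLowerTail` (lead of the one-cut line, gen 3;
`--supports stmt-CriticalPhenomena-4575`).  No definitions, no named facts, no sorries.

Notation: `μ = prodBernoulli w` on a finite vertex type, relays `A`, observer `o ∉ A`, level `j`,
`N = |{x ∈ A : o ↔ x}|`, `π(v) = {x ∈ A : v ↔ x}`; `G ∖ o` = open paths avoiding `o` (`openConnIn {o}ᶜ`).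
The tree's `Theorems.cumulativeIsolation_preFKG_of_isolatedObserver` (Kozma–Nitzan, arXiv:2401.12397, Thm 8)
proves the cumulative isolation lemma `CIL_j : μ{1 ≤ N ≤ j} ≤ max_a μ{|π(a)| ≤ j}` for observers joined ONLY
to relays.  The engine of that proof, Kozma–Nitzan's Lemma 5 (tree: `KozmaNitzan2024_lemma5_cluster`), needs
neither that the compared vertex `v` of the star pattern be a relay nor that the witness be a neighbour; summing
it over ALL star patterns of `o` gives:

* `thm8_event_of_dominatedNeighbours` — Theorem 8 in event form for a monotone cluster property `P`, with the
  isolation hypothesis REPLACED by domination: every positive-weight non-relay neighbour `u` of `o` is at least as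
  `P`-likely in `G ∖ o` as some relay.  Conclusion: for some `a ∈ A`,
  `μ({P(C(a))} ∩ D) ≤ μ({P(C(o))} ∩ D)`, `D` = "`o` has an open edge".
* `cumulativeIsolation_preFKG_of_dominatedNeighbours`, `cumulativeIsolation_of_dominatedNeighbours` — **CIL at
  every level `j`, for every `|A|` and every weighted graph in which each positive-weight non-relay neighbour
  `u` of `o` satisfies `μ_{G∖o}(|π(u)| ≥ j+1) ≥ min_{a ∈ A} μ_{G∖o}(|π(a)| ≥ j+1)`** (the neighbour is "no more
  detached than the most detached relay", clusters read in `G ∖ o`); witness = a relay minimising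
  `μ_{G∖o}(|π(a)| ≥ j+1)`.  Relay neighbours need no hypothesis, so the isolated-observer theorem is the special
  case "no non-relay neighbour" (`cumulativeIsolation_of_isolatedObserver'`).

Reading for the planners (lead memo LEAD-GEN3.md §2): the residual of the crux's CIL engine is thereby confined to
observers having a SUPER-DETACHED Steiner neighbour `u` (`μ_{G∖o}(|π(u)| ≤ j) > max_a μ_{G∖o}(|π(a)| ≤ j)`: a thin
filament or dead end next to `o`); in the lead's census (6.8·10⁵ random weighted instances, `n ≤ 8`, `|A| ≤ 5`,
observers with and without relay neighbours) 68–84 % of instances have no such neighbour.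
-/

noncomputable section

namespace Summit.CriticalPhenomena.PercolationContinuityZ3.Theorems

open MeasureTheory Set Literature.Probability.LatticeModels Literature.Probability.Percolation
open scoped Classical BigOperators

/-! ### Theorem 8 without isolation: dominated non-relay neighbours -/

section General

variable {V : Type*} [Fintype V]

omit [Fintype V] in
/-- If `o ↔ x` for some `x ≠ o` then `o` has an open edge. [folklore] -/
theorem exists_open_edge_of_reachable {ω : BondConfig V} {o x : V} (hx : x ≠ o)
    (h : (openGraph ω).Reachable o x) : ∃ u, u ≠ o ∧ s(o, u) ∈ ω := by
  rw [SimpleGraph.reachable_iff_reflTransGen] at h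
  rcases Relation.ReflTransGen.cases_head h with h0 | ⟨c, hc, -⟩
  · exact absurd h0.symm hx
  · rw [openGraph_adj] at hc
    exact ⟨c, hc.2.symm, hc.1⟩

omit [Fintype V] in
/-- A nonempty star pattern forces an open edge at `o`. [folklore] -/
theorem starEvent_subset_exists_open (o : V) {B : Finset V} {v : V} (hv : v ∈ B) (hvo : v ≠ o) :
    starEvent o (↑B : Set V) ⊆ {ω : BondConfig V | ∃ u, u ≠ o ∧ s(o, u) ∈ ω} := fun ω hσ =>
  ⟨v, hvo, ((mem_starEvent_iff o (↑B) ω).1 hσ v hvo).2 (Finset.mem_coe.2 hv)⟩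

/-- **Kozma–Nitzan's Theorem 8 with the isolation hypothesis replaced by domination.**  Let `P` be a
monotone property of vertex sets, `A ≠ ∅` a relay set with `o ∉ A`, and suppose every non-relay `u ≠ o`
with `w s(o,u) ≠ 0` is DOMINATED: some relay `a` has `μ(P(C_{G∖o}(a))) ≤ μ(P(C_{G∖o}(u)))`.  Then some
`a ∈ A` (a minimiser of `μ(P(C_{G∖o}(a)))`) satisfies `μ({P(C(a))} ∩ D) ≤ μ({P(C(o))} ∩ D)` where
`D = {o has an open edge}`.  Proof: decompose along the star patterns `σ_B`, `B ⊆ V ∖ o`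
(`KNPreFKG.real_eq_sum_inter_starEvent` with the full neighbour set); for `B ≠ ∅` apply Lemma 5
(`KozmaNitzan2024_lemma5_cluster`) with `v ∈ B` a relay (minimality) or a dominated non-relay (hypothesis);
patterns through a weight-`0` pair are null. [this work; cite: KozmaNitzan2024, Lemma 5 (p. 13), Thm. 8 (p. 32)] -/
theorem thm8_event_of_dominatedNeighbours (w : Sym2 V → unitInterval) (A : Finset V) (o : V)
    (P : Set V → Prop) (hP : ∀ S T : Set V, S ⊆ T → P S → P T) (hA : A.Nonempty) (hoA : o ∉ A)
    (hdom : ∀ u, u ≠ o → u ∉ A → w s(o, u) ≠ 0 → ∃ a ∈ A,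
      (prodBernoulli w).real {ω | P {y | ω ∈ openConnIn ({o}ᶜ : Set V) a y}} ≤
        (prodBernoulli w).real {ω | P {y | ω ∈ openConnIn ({o}ᶜ : Set V) u y}}) :
    ∃ a ∈ A, (prodBernoulli w).real ({ω | P (openCluster ω a)} ∩ {ω | ∃ u, u ≠ o ∧ s(o, u) ∈ ω}) ≤
      (prodBernoulli w).real ({ω | P (openCluster ω o)} ∩ {ω | ∃ u, u ≠ o ∧ s(o, u) ∈ ω}) := by
  classical
  set μ := prodBernoulli w with hμ
  set D : Set (BondConfig V) := {ω | ∃ u, u ≠ o ∧ s(o, u) ∈ ω} with hD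
  -- `a₀` minimising `P_{G ∖ {0}}(P(C(a)))` over `A`
  obtain ⟨a₀, ha₀, hmin⟩ := A.exists_min_image
    (fun a => μ.real {ω | P {y | ω ∈ openConnIn ({o}ᶜ : Set V) a y}}) hA
  refine ⟨a₀, ha₀, ?_⟩
  have ha₀o : a₀ ≠ o := fun h => hoA (h ▸ ha₀)
  -- star decomposition over ALL patterns `B ⊆ V ∖ {o}`
  set T : Finset V := Finset.univ.erase o with hT
  have hoT : o ∉ T := by simp [hT]
  have hisoT : ∀ u, u ≠ o → u ∉ T → w s(o, u) = 0 := by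
    intro u huo huT
    exact absurd (by simp [hT, huo]) huT
  rw [KNPreFKG.real_eq_sum_inter_starEvent w T o hoT hisoT ({ω | P (openCluster ω a₀)} ∩ D),
    KNPreFKG.real_eq_sum_inter_starEvent w T o hoT hisoT ({ω | P (openCluster ω o)} ∩ D)]
  refine Finset.sum_le_sum fun B hB => ?_
  have hBT : B ⊆ T := Finset.mem_powerset.1 hB
  rcases B.eq_empty_or_nonempty with rfl | ⟨v, hv⟩
  · -- `B = ∅`: the left term vanishes (`σ_∅` forbids an open edge at `o`)
    have h0 : ({ω | P (openCluster ω a₀)} ∩ D) ∩ starEvent o ↑(∅ : Finset V) =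
        (∅ : Set (BondConfig V)) := by
      ext ω
      refine ⟨?_, fun h => h.elim⟩
      rintro ⟨⟨-, u, huo, hu⟩, hσ⟩
      rw [Finset.coe_empty] at hσ
      exact ((mem_starEvent_iff o ∅ ω).1 hσ u huo).1 hu
    rw [h0, measureReal_empty]
    exact measureReal_nonneg
  · have hvo : v ≠ o := by
      have := hBT hv
      simp [hT] at this
      exact this
    have hσD : starEvent o (↑B : Set V) ⊆ D := starEvent_subset_exists_open o hv hvo
    -- either some pattern pair is a weight-0 pair (null pattern) or Lemma 5 applies with some `v' ∈ B`
    by_cases hnull : ∃ u ∈ B, u ∉ A ∧ w s(o, u) = 0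
    · obtain ⟨u, huB, -, hwu⟩ := hnull
      have huo : u ≠ o := by
        have := hBT huB
        simp [hT] at this
        exact this
      have hσ0 : μ.real (starEvent o (↑B : Set V)) = 0 := by
        refine le_antisymm ?_ measureReal_nonneg
        calc μ.real (starEvent o (↑B : Set V)) ≤ μ.real {ω : BondConfig V | s(o, u) ∈ ω} :=
              measureReal_mono (fun ω hσ =>
                ((mem_starEvent_iff o (↑B) ω).1 hσ u huo).2 (Finset.mem_coe.2 huB))
          _ = 0 := by rw [hμ, prodBernoulli_real_setOf_mem, hwu]; rfl
      have hl : μ.real (({ω | P (openCluster ω a₀)} ∩ D) ∩ starEvent o ↑B) = 0 :=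
        le_antisymm ((measureReal_mono inter_subset_right).trans hσ0.le) measureReal_nonneg
      rw [hl]
      exact measureReal_nonneg
    · push Not at hnull
      -- a vertex of `B` dominated by `a₀` in `G ∖ o`
      have hcmp : ∃ v' ∈ B, μ.real {ω | P {y | ω ∈ openConnIn ({o}ᶜ : Set V) a₀ y}} ≤
          μ.real {ω | P {y | ω ∈ openConnIn ({o}ᶜ : Set V) v' y}} := by
        by_cases hvA : v ∈ A
        · exact ⟨v, hv, hmin v hvA⟩
        · obtain ⟨a, ha, hle⟩ := hdom v hvo hvA (hnull v hv hvA)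
          exact ⟨v, hv, (hmin a ha).trans hle⟩
      obtain ⟨v', hv', hle⟩ := hcmp
      have hv'o : v' ≠ o := by
        have := hBT hv'
        simp [hT] at this
        exact this
      have L5 := KozmaNitzan2024_lemma5_cluster w o a₀ v' (↑B) P hP ha₀o hv'o (Finset.mem_coe.2 hv') hle
      calc μ.real (({ω | P (openCluster ω a₀)} ∩ D) ∩ starEvent o ↑B)
          ≤ μ.real ({ω | P (openCluster ω a₀)} ∩ starEvent o ↑B) :=
            measureReal_mono fun ω ⟨⟨h1, _⟩, h2⟩ => ⟨h1, h2⟩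
        _ ≤ μ.real ({ω | P (openCluster ω o)} ∩ starEvent o ↑B) := L5
        _ ≤ μ.real (({ω | P (openCluster ω o)} ∩ D) ∩ starEvent o ↑B) :=
            measureReal_mono fun ω ⟨h1, h2⟩ => ⟨⟨h1, hσD h2⟩, h2⟩

end General

/-! ### The cumulative isolation lemma for dominated neighbours -/

variable {n : ℕ}

/-- **CIL in pre-FKG form when every non-relay neighbour of the observer is dominated.**  Let `A ≠ ∅`,
`o ∉ A`, and suppose that for every `u ∉ A`, `u ≠ o` with `w s(o,u) ≠ 0` some relay `a ∈ A` has
`μ_{G∖o}(|π(a)| ≥ j+1) ≤ μ_{G∖o}(|π(u)| ≥ j+1)` (clusters read off open paths avoiding `o`).  Then some relay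
`a ∈ A` satisfies `μ{1 ≤ N ≤ j} ≤ μ({o has an open edge} ∩ {|π(a)| ≤ j}) ≤ μ{|π(a)| ≤ j}`.
(`thm8_event_of_dominatedNeighbours` for the cluster property `|C(·) ∩ A| ≥ j+1`, and
`{1 ≤ N ≤ j} ⊆ {o has an open edge} ∖ {N ≥ j+1}`.) [this work] -/
theorem cumulativeIsolation_preFKG_of_dominatedNeighbours (w : Sym2 (Fin n) → unitInterval)
    (A : Finset (Fin n)) (o : Fin n) (j : ℕ) (hA : A.Nonempty) (hoA : o ∉ A)
    (hdom : ∀ u, u ≠ o → u ∉ A → w s(o, u) ≠ 0 → ∃ a ∈ A,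
      (prodBernoulli w).real {ω : BondConfig (Fin n) |
          j + 1 ≤ (A.filter fun x => ω ∈ openConnIn ({o}ᶜ : Set (Fin n)) a x).card} ≤
        (prodBernoulli w).real {ω : BondConfig (Fin n) |
          j + 1 ≤ (A.filter fun x => ω ∈ openConnIn ({o}ᶜ : Set (Fin n)) u x).card}) :
    ∃ a ∈ A,
      (prodBernoulli w).real {ω : BondConfig (Fin n) |
          1 ≤ (A.filter fun x => ω ∈ openConn o x).card ∧
            (A.filter fun x => ω ∈ openConn o x).card ≤ j} ≤
        (prodBernoulli w).real ({ω : BondConfig (Fin n) | ∃ u, u ≠ o ∧ s(o, u) ∈ ω} ∩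
          {ω : BondConfig (Fin n) | (A.filter fun x => ω ∈ openConn a x).card ≤ j}) := by
  set μ := prodBernoulli w with hμ
  -- the monotone cluster property `|C ∩ A| ≥ j+1`
  set P : Set (Fin n) → Prop := fun S => j + 1 ≤ (A.filter fun x => x ∈ S).card with hP
  have hPmono : ∀ S T : Set (Fin n), S ⊆ T → P S → P T :=
    fun S T hST hS => le_trans hS (card_filter_mem_mono A hST)
  have hdom' : ∀ u, u ≠ o → u ∉ A → w s(o, u) ≠ 0 → ∃ a ∈ A,
      μ.real {ω | P {y | ω ∈ openConnIn ({o}ᶜ : Set (Fin n)) a y}} ≤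
        μ.real {ω | P {y | ω ∈ openConnIn ({o}ᶜ : Set (Fin n)) u y}} := by
    intro u huo huA hwu
    obtain ⟨a, ha, hle⟩ := hdom u huo huA hwu
    refine ⟨a, ha, ?_⟩
    have e : ∀ v : Fin n, {ω : BondConfig (Fin n) | P {y | ω ∈ openConnIn ({o}ᶜ : Set (Fin n)) v y}} =
        {ω | j + 1 ≤ (A.filter fun x => ω ∈ openConnIn ({o}ᶜ : Set (Fin n)) v x).card} := by
      intro v; ext ω; simp only [hP, mem_setOf_eq]
    rw [e, e]
    exact hle
  obtain ⟨a₀, ha₀, h8⟩ := thm8_event_of_dominatedNeighbours w A o P hPmono hA hoA hdom'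
  refine ⟨a₀, ha₀, ?_⟩
  set D : Set (BondConfig (Fin n)) := {ω | ∃ u, u ≠ o ∧ s(o, u) ∈ ω} with hD
  set Uo : Set (BondConfig (Fin n)) := {ω | P (openCluster ω o)} with hUo
  set Ua : Set (BondConfig (Fin n)) := {ω | P (openCluster ω a₀)} with hUa
  -- `{1 ≤ N ≤ j} ⊆ D ∖ Uo`
  have hL : {ω : BondConfig (Fin n) | 1 ≤ (A.filter fun x => ω ∈ openConn o x).card ∧
      (A.filter fun x => ω ∈ openConn o x).card ≤ j} ⊆ D \ Uo := by
    rintro ω ⟨h1, h2⟩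
    refine ⟨?_, ?_⟩
    · obtain ⟨x, hx⟩ := Finset.card_pos.1 (Nat.succ_le_iff.1 h1)
      rw [Finset.mem_filter] at hx
      exact exists_open_edge_of_reachable (fun h => hoA (h ▸ hx.1)) hx.2
    · simp only [hUo, hP, mem_setOf_eq, card_filter_mem_openCluster, not_le]
      omega
  -- `D ∖ Ua ⊆ D ∩ {|π(a₀)| ≤ j}`
  have hT : D \ Ua ⊆ D ∩ {ω : BondConfig (Fin n) | (A.filter fun x => ω ∈ openConn a₀ x).card ≤ j} := by
    rintro ω ⟨hωD, hωU⟩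
    refine ⟨hωD, ?_⟩
    simp only [hUa, hP, mem_setOf_eq, card_filter_mem_openCluster, not_le] at hωU
    simp only [mem_setOf_eq]
    omega
  have e1 : μ.real (D ∩ Uo) + μ.real (D \ Uo) = μ.real D :=
    measureReal_inter_add_sdiff (MeasurableSet.of_discrete : MeasurableSet Uo) (measure_ne_top _ _)
  have e2 : μ.real (D ∩ Ua) + μ.real (D \ Ua) = μ.real D :=
    measureReal_inter_add_sdiff (MeasurableSet.of_discrete : MeasurableSet Ua) (measure_ne_top _ _)
  have h8' : μ.real (D ∩ Ua) ≤ μ.real (D ∩ Uo) := by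
    rw [inter_comm D Ua, inter_comm D Uo]
    exact h8
  calc μ.real {ω : BondConfig (Fin n) | 1 ≤ (A.filter fun x => ω ∈ openConn o x).card ∧
          (A.filter fun x => ω ∈ openConn o x).card ≤ j}
      ≤ μ.real (D \ Uo) := measureReal_mono hL
    _ = μ.real D - μ.real (D ∩ Uo) := by linarith
    _ ≤ μ.real D - μ.real (D ∩ Ua) := by linarith
    _ = μ.real (D \ Ua) := by linarith
    _ ≤ μ.real (D ∩ {ω : BondConfig (Fin n) | (A.filter fun x => ω ∈ openConn a₀ x).card ≤ j}) :=
        measureReal_mono hT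

/-- **The cumulative isolation lemma for observers with dominated non-relay neighbours** — the conclusion
of the registered stub `stub_cumulativeIsolation` (crux `NoHeavyLowerTail`, stmt-CriticalPhenomena-4575) on
this class, at every level `j` and for every `|A|`: if `A ≠ ∅`, `o ∉ A`, and every positive-weight non-relay
neighbour `u` of `o` is no more detached in `G ∖ o` than the most detached relay
(`∃ a ∈ A, μ_{G∖o}(|π(a)| ≥ j+1) ≤ μ_{G∖o}(|π(u)| ≥ j+1)`), then some `a ∈ A` has
`μ{1 ≤ N ≤ j} ≤ μ{|π(a)| ≤ j}`.  Strictly contains `Theorems.cumulativeIsolation_of_isolatedObserver`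
(no non-relay neighbour at all). [this work] -/
theorem cumulativeIsolation_of_dominatedNeighbours (w : Sym2 (Fin n) → unitInterval)
    (A : Finset (Fin n)) (o : Fin n) (j : ℕ) (hA : A.Nonempty) (hoA : o ∉ A)
    (hdom : ∀ u, u ≠ o → u ∉ A → w s(o, u) ≠ 0 → ∃ a ∈ A,
      (prodBernoulli w).real {ω : BondConfig (Fin n) |
          j + 1 ≤ (A.filter fun x => ω ∈ openConnIn ({o}ᶜ : Set (Fin n)) a x).card} ≤
        (prodBernoulli w).real {ω : BondConfig (Fin n) |
          j + 1 ≤ (A.filter fun x => ω ∈ openConnIn ({o}ᶜ : Set (Fin n)) u x).card}) :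
    ∃ a ∈ A,
      (prodBernoulli w).real {ω : BondConfig (Fin n) |
          1 ≤ (A.filter fun x => ω ∈ openConn o x).card ∧
            (A.filter fun x => ω ∈ openConn o x).card ≤ j} ≤
        (prodBernoulli w).real {ω : BondConfig (Fin n) |
          (A.filter fun x => ω ∈ openConn a x).card ≤ j} := by
  obtain ⟨a, ha, h⟩ := cumulativeIsolation_preFKG_of_dominatedNeighbours w A o j hA hoA hdom
  exact ⟨a, ha, h.trans (measureReal_mono inter_subset_right)⟩

/-- **The isolated-observer case recovered**: if every non-relay `u ≠ o` has `w s(o,u) = 0`, the domination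
hypothesis is vacuous. (Same conclusion as `Theorems.cumulativeIsolation_of_isolatedObserver`, under the
extra harmless hypothesis `o ∉ A`.) [this work] -/
theorem cumulativeIsolation_of_isolatedObserver' (w : Sym2 (Fin n) → unitInterval)
    (A : Finset (Fin n)) (o : Fin n) (j : ℕ) (hA : A.Nonempty) (hoA : o ∉ A)
    (hiso : ∀ u, u ≠ o → u ∉ A → w s(o, u) = 0) :
    ∃ a ∈ A,
      (prodBernoulli w).real {ω : BondConfig (Fin n) |
          1 ≤ (A.filter fun x => ω ∈ openConn o x).card ∧
            (A.filter fun x => ω ∈ openConn o x).card ≤ j} ≤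
        (prodBernoulli w).real {ω : BondConfig (Fin n) |
          (A.filter fun x => ω ∈ openConn a x).card ≤ j} :=
  cumulativeIsolation_of_dominatedNeighbours w A o j hA hoA
    fun u huo huA hwu => absurd (hiso u huo huA) hwu

/-! ### The same star surgery on the sibling cruxes: Kozma–Nitzan's pre-FKG inequality (3) at observers
with dominated neighbours (Theorem 4 without isolation) -/

section PreFKG

variable {V : Type*} [Fintype V]

/-- **Kozma–Nitzan's pre-FKG inequality (3) at an observer whose non-relay neighbours are dominated**
(their Theorem 4, p. 12, with "`0` isolated in `G ∖ A`" replaced by domination).  Let `A ≠ ∅`, `o ∉ A`, and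
suppose every non-relay `u ≠ o` with `w s(o,u) ≠ 0` is at least as well joined to `b` in `G ∖ o` as some
relay: `∃ a ∈ A, μ(a ↔ b off o) ≤ μ(u ↔ b off o)`.  Then some `a ∈ A` has `μ(o ↔ A, a ↔ b) ≤ μ(o ↔ b)`, i.e.
`P(0 ↔ b) ≥ min_{a ∈ A} P(0 ↔ A, a ↔ b)` — inequality (3) of arXiv:2401.12397 (the pre-FKG form of their
Conjectures 1–3, cruxes stmt-CriticalPhenomena-4574/4576) holds at `o`.  (`thm8_event_of_dominatedNeighbours`
for the monotone cluster property `b ∈ C(·)`, and `{o ↔ A} ⊆ {o has an open edge}`.) [this work; cite: KozmaNitzan2024, Thm. 4 (p. 12), Lemma 5 (p. 13)] -/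
theorem preFKG_of_dominatedNeighbours (w : Sym2 V → unitInterval) (A : Finset V) (o b : V)
    (hA : A.Nonempty) (hoA : o ∉ A)
    (hdom : ∀ u, u ≠ o → u ∉ A → w s(o, u) ≠ 0 → ∃ a ∈ A,
      (prodBernoulli w).real (openConnIn ({o}ᶜ : Set V) a b) ≤
        (prodBernoulli w).real (openConnIn ({o}ᶜ : Set V) u b)) :
    ∃ a ∈ A, (prodBernoulli w).real ((⋃ a' ∈ A, (openConn o a' : Set (BondConfig V))) ∩ openConn a b) ≤
      (prodBernoulli w).real (openConn o b) := by
  classical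
  set μ := prodBernoulli w with hμ
  -- the monotone cluster property `b ∈ S`
  set P : Set V → Prop := fun S => b ∈ S with hP
  have hPmono : ∀ S T : Set V, S ⊆ T → P S → P T := fun S T hST hS => hST hS
  have hdom' : ∀ u, u ≠ o → u ∉ A → w s(o, u) ≠ 0 → ∃ a ∈ A,
      μ.real {ω | P {y | ω ∈ openConnIn ({o}ᶜ : Set V) a y}} ≤
        μ.real {ω | P {y | ω ∈ openConnIn ({o}ᶜ : Set V) u y}} := by
    intro u huo huA hwu
    obtain ⟨a, ha, hle⟩ := hdom u huo huA hwu
    have e : ∀ v : V, {ω : BondConfig V | P {y | ω ∈ openConnIn ({o}ᶜ : Set V) v y}} =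
        openConnIn ({o}ᶜ : Set V) v b := by
      intro v; ext ω; simp only [hP, mem_setOf_eq]
    refine ⟨a, ha, ?_⟩
    rw [e, e]
    exact hle
  obtain ⟨a₀, ha₀, h8⟩ := thm8_event_of_dominatedNeighbours w A o P hPmono hA hoA hdom'
  refine ⟨a₀, ha₀, ?_⟩
  set D : Set (BondConfig V) := {ω | ∃ u, u ≠ o ∧ s(o, u) ∈ ω} with hD
  -- `{o ↔ A} ⊆ D`
  have hRD : (⋃ a' ∈ A, (openConn o a' : Set (BondConfig V))) ⊆ D := by
    intro ω hω
    simp only [mem_iUnion, exists_prop] at hω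
    obtain ⟨x, hx, hox⟩ := hω
    exact exists_open_edge_of_reachable (fun h => hoA (h ▸ hx)) hox
  have e1 : {ω : BondConfig V | P (openCluster ω a₀)} = openConn a₀ b := by
    ext ω; simp only [hP, mem_setOf_eq, openCluster, openConn]
  have e2 : {ω : BondConfig V | P (openCluster ω o)} = openConn o b := by
    ext ω; simp only [hP, mem_setOf_eq, openCluster, openConn]
  rw [e1, e2] at h8
  calc μ.real ((⋃ a' ∈ A, (openConn o a' : Set (BondConfig V))) ∩ openConn a₀ b)
      ≤ μ.real (openConn a₀ b ∩ D) :=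
        measureReal_mono fun ω ⟨h1, h2⟩ => ⟨h2, hRD h1⟩
    _ ≤ μ.real (openConn o b ∩ D) := h8
    _ ≤ μ.real (openConn o b) := measureReal_mono inter_subset_left

end PreFKG

/-! ### The canonical-witness form ("Q9-CIL") closes the engine

The conclusion SHAPE of the theorems above — witness = a relay most detached in `G ∖ o` — is conjecturally valid
for every observer (Kozma–Nitzan's Question 9, p. 36, asked for the cluster-size property; lead census gen 3:
0 violations in 1.47·10⁶ exact weighted instances, `n ≤ 8`, `|A| ≤ 5`, all levels, LEAD-GEN3.md §5).  Recorded here as a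
typed target: a proof of the canonical-witness form for all observers gives the registered stub
`stub_cumulativeIsolation` and hence the crux. -/

/-- **Q9-CIL ⇒ CIL.**  If for every weighted graph, every nonempty relay set `A`, every observer `o ∉ A`, every
level `j` and EVERY relay `a₀` maximising `μ_{G∖o}(|π(·)| ≤ j)` over `A` (equivalently minimising
`μ_{G∖o}(|π(·)| ≥ j+1)`) one has `μ{1 ≤ N ≤ j} ≤ μ{|π(a₀)| ≤ j}`, then the cumulative isolation lemma holds in the
registered `∃ a ∈ A` form (hypothesis shape of `Theorems.noHeavyLowerTail_of_stub_cumulativeIsolation`).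
[this work; cite: KozmaNitzan2024, Question 9 (p. 36)] -/
theorem cumulativeIsolation_of_canonicalWitness
    (hQ9 : ∀ (n : ℕ) (w : Sym2 (Fin n) → unitInterval) (A : Finset (Fin n)) (o : Fin n) (j : ℕ) (a₀ : Fin n),
      A.Nonempty → o ∉ A → a₀ ∈ A →
      (∀ a ∈ A,
        (prodBernoulli w).real {ω : BondConfig (Fin n) |
            j + 1 ≤ (A.filter fun x => ω ∈ openConnIn ({o}ᶜ : Set (Fin n)) a₀ x).card} ≤
          (prodBernoulli w).real {ω : BondConfig (Fin n) |
            j + 1 ≤ (A.filter fun x => ω ∈ openConnIn ({o}ᶜ : Set (Fin n)) a x).card}) →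
      (prodBernoulli w).real {ω : BondConfig (Fin n) |
          1 ≤ (A.filter fun x => ω ∈ openConn o x).card ∧
            (A.filter fun x => ω ∈ openConn o x).card ≤ j} ≤
        (prodBernoulli w).real {ω : BondConfig (Fin n) |
          (A.filter fun x => ω ∈ openConn a₀ x).card ≤ j})
    (n : ℕ) (w : Sym2 (Fin n) → unitInterval) (A : Finset (Fin n)) (o : Fin n) (j : ℕ)
    (hA : A.Nonempty) (ho : o ∉ A) :
    ∃ a ∈ A,
      (Literature.Probability.LatticeModels.prodBernoulli w).real
          {ω : Literature.Probability.Percolation.BondConfig (Fin n) |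
            1 ≤ (A.filter fun x => ω ∈ Literature.Probability.Percolation.openConn o x).card ∧
              (A.filter fun x => ω ∈ Literature.Probability.Percolation.openConn o x).card ≤ j} ≤
        (Literature.Probability.LatticeModels.prodBernoulli w).real
          {ω : Literature.Probability.Percolation.BondConfig (Fin n) |
            (A.filter fun x => ω ∈ Literature.Probability.Percolation.openConn a x).card ≤ j} := by
  -- a relay `a₀` minimising `μ_{G∖o}(|π(a)| ≥ j+1)` over `A`
  obtain ⟨a₀, ha₀, hmin⟩ := A.exists_min_image
    (fun a => (prodBernoulli w).real {ω : BondConfig (Fin n) |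
      j + 1 ≤ (A.filter fun x => ω ∈ openConnIn ({o}ᶜ : Set (Fin n)) a x).card}) hA
  exact ⟨a₀, ha₀, hQ9 n w A o j a₀ hA ho ha₀ hmin⟩

/-- **Q9-CIL ⇒ the crux `NoHeavyLowerTail`** (through `Theorems.noHeavyLowerTail_of_stub_cumulativeIsolation`).
[this work; cite: KozmaNitzan2024, Question 9 (p. 36)] -/
theorem noHeavyLowerTail_of_canonicalWitness
    (hQ9 : ∀ (n : ℕ) (w : Sym2 (Fin n) → unitInterval) (A : Finset (Fin n)) (o : Fin n) (j : ℕ) (a₀ : Fin n),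
      A.Nonempty → o ∉ A → a₀ ∈ A →
      (∀ a ∈ A,
        (prodBernoulli w).real {ω : BondConfig (Fin n) |
            j + 1 ≤ (A.filter fun x => ω ∈ openConnIn ({o}ᶜ : Set (Fin n)) a₀ x).card} ≤
          (prodBernoulli w).real {ω : BondConfig (Fin n) |
            j + 1 ≤ (A.filter fun x => ω ∈ openConnIn ({o}ᶜ : Set (Fin n)) a x).card}) →
      (prodBernoulli w).real {ω : BondConfig (Fin n) |
          1 ≤ (A.filter fun x => ω ∈ openConn o x).card ∧
            (A.filter fun x => ω ∈ openConn o x).card ≤ j} ≤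
        (prodBernoulli w).real {ω : BondConfig (Fin n) |
          (A.filter fun x => ω ∈ openConn a₀ x).card ≤ j}) :
    Summit.CriticalPhenomena.PercolationContinuityZ3.Theses.PercNearOneGluing.NoHeavyLowerTail :=
  noHeavyLowerTail_of_stub_cumulativeIsolation (cumulativeIsolation_of_canonicalWitness hQ9)

end Summit.CriticalPhenomena.PercolationContinuityZ3.Theorems
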